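import Summits.NavierStokesRegularity.NavierStokesRegularity.Theorems.EulerZoomLiouvillePowerGaugeEulerLiouvillePowerClockRigidityProfile
import Summits.NavierStokesRegularity.NavierStokesRegularity.Theorems.EulerZoomLiouvillePowerGaugeEulerLiouvilleBreatherPressure

/-!
# Crux `EulerZoomLiouville.PowerGaugeEulerLiouville` (stmt-NavierStokesRegularity-19832), line `logtime-breathers` (T4):
# the AVERAGED slice pressure of a classical power clock about `T₀ ≥ 0` and its `D`-growth

Width seat `ns-ezl-w4` (power-clock rigidity, file III; twin of `…BreatherPressure`).  For a classical Euler pair with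
`u(τ, y) = (T₀−τ)^{γ−1} W((T₀−τ)^{−γ} y)` the slice pressures `P_τ(z) = ((T₀−τ)^{γ−1})^{−2} p(τ, (T₀−τ)^{γ} z)` solve the profile
equation and differ by constants; their AVERAGE `P̄ = ∫_{(−2,−1)} P_τ dτ = P_{−1} + const` (`exists_avgPressure_eq_add_const`) solves it
too (`profile_equation_avg`) and its `L^{3/2}` growth is controlled by the `D`-gauge without loss
(`lintegral_ball_avgPressure_le`, `0 ≤ γ ≤ 1`: pointwise power mean `BreatherRigidity.enorm_setIntegral_rpow_le`, Tonelli, slice dilation).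

WHAT THIS IS NOT: not NS regularity, not the crux — the pressure brick of the power-clock rigidity member; `--supports`
stmt-19832. [folklore]
-/

noncomputable section

set_option linter.dupNamespace false

open MeasureTheory Set Filter Topology Metric Function TopologicalSpace
open scoped ENNReal NNReal RealInnerProductSpace ContDiff

namespace Summit.NavierStokesRegularity.NavierStokesRegularity.Theorems.PowerGaugeEulerLiouville

open Literature.Analysis Literature.Analysis.FunctionSpaces Literature.Analysis.FluidPDE

namespace PowerClockRigidity

variable {u : ℝ → EuclideanSpace ℝ (Fin 3) → EuclideanSpace ℝ (Fin 3)} {p : ℝ → EuclideanSpace ℝ (Fin 3) → ℝ}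
  {T₀ g : ℝ} {W : EuclideanSpace ℝ (Fin 3) → EuclideanSpace ℝ (Fin 3)}

/-! ### Continuity of the slice-pressure family -/

/-- The slice-pressure family `(τ, z) ↦ ((T₀−τ)^{γ−1})^{−2} p(τ, (T₀−τ)^{γ} z)` of a classical pair is continuous on `(−∞,0) × ℝ³`
(`T₀ ≥ 0`). [folklore] -/
theorem continuousOn_slicePressure_uncurry (hcl : IsClassicalEulerSolutionOn (Iio 0) 0 u p) (hT₀ : 0 ≤ T₀) :
    ContinuousOn (fun q : ℝ × EuclideanSpace ℝ (Fin 3) =>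
      (((T₀ - q.1) ^ (g - 1)) ^ 2)⁻¹ * p q.1 ((T₀ - q.1) ^ g • q.2)) (Iio (0 : ℝ) ×ˢ univ) := by
  have hp : ContinuousOn (uncurry p) (Iio (0 : ℝ) ×ˢ univ) := hcl.smooth_pressure.continuousOn
  have hbase : ContinuousOn (fun q : ℝ × EuclideanSpace ℝ (Fin 3) => T₀ - q.1) (Iio (0 : ℝ) ×ˢ univ) := by fun_prop
  have hne : ∀ q ∈ Iio (0 : ℝ) ×ˢ (univ : Set (EuclideanSpace ℝ (Fin 3))), T₀ - q.1 ≠ 0 ∨ 0 ≤ g := fun q hq => by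
    left; have : q.1 < 0 := hq.1; linarith
  have hne' : ∀ q ∈ Iio (0 : ℝ) ×ˢ (univ : Set (EuclideanSpace ℝ (Fin 3))), T₀ - q.1 ≠ 0 ∨ 0 ≤ g - 1 := fun q hq => by
    left; have : q.1 < 0 := hq.1; linarith
  have hℓ : ContinuousOn (fun q : ℝ × EuclideanSpace ℝ (Fin 3) => (T₀ - q.1) ^ g) (Iio (0 : ℝ) ×ˢ univ) :=
    hbase.rpow_const hne
  have hθ : ContinuousOn (fun q : ℝ × EuclideanSpace ℝ (Fin 3) => (T₀ - q.1) ^ (g - 1)) (Iio (0 : ℝ) ×ˢ univ) :=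
    hbase.rpow_const hne'
  have hmap : ContinuousOn (fun q : ℝ × EuclideanSpace ℝ (Fin 3) => (q.1, (T₀ - q.1) ^ g • q.2)) (Iio (0 : ℝ) ×ˢ univ) :=
    continuousOn_fst.prodMk (hℓ.smul continuousOn_snd)
  have hmaps : MapsTo (fun q : ℝ × EuclideanSpace ℝ (Fin 3) => (q.1, (T₀ - q.1) ^ g • q.2))
      (Iio (0 : ℝ) ×ˢ univ) (Iio (0 : ℝ) ×ˢ univ) := fun q hq => ⟨hq.1, mem_univ _⟩
  have h1 : ContinuousOn (fun q : ℝ × EuclideanSpace ℝ (Fin 3) => p q.1 ((T₀ - q.1) ^ g • q.2))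
      (Iio (0 : ℝ) ×ˢ univ) := hp.comp hmap hmaps
  have h2 : ContinuousOn (fun q : ℝ × EuclideanSpace ℝ (Fin 3) => (((T₀ - q.1) ^ (g - 1)) ^ 2)⁻¹) (Iio (0 : ℝ) ×ˢ univ) := by
    refine (hθ.pow 2).inv₀ fun q hq => ?_
    have : q.1 < 0 := hq.1
    exact pow_ne_zero _ (Real.rpow_pos_of_pos (by linarith) _).ne'
  exact h2.mul h1

/-- Continuity of `τ ↦ P_τ(z)` on `(−∞, 0)` at a fixed point `z`. [folklore] -/
theorem continuousOn_slicePressure_time (hcl : IsClassicalEulerSolutionOn (Iio 0) 0 u p) (hT₀ : 0 ≤ T₀)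
    (z : EuclideanSpace ℝ (Fin 3)) :
    ContinuousOn (fun τ : ℝ => (((T₀ - τ) ^ (g - 1)) ^ 2)⁻¹ * p τ ((T₀ - τ) ^ g • z)) (Iio 0) := by
  have hφ : Continuous fun τ : ℝ => ((τ, z) : ℝ × EuclideanSpace ℝ (Fin 3)) := by fun_prop
  have h := (continuousOn_slicePressure_uncurry (g := g) hcl hT₀).comp (hφ.continuousOn (s := Iio (0 : ℝ)))
    (fun τ hτ => ⟨hτ, mem_univ _⟩)
  refine h.congr fun τ _ => ?_
  simp only [Function.comp_apply]

/-! ### The averaged slice pressure is a slice pressure up to a constant -/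

/-- **`P̄ = P_{−1} + const`.**  The average `P̄(z) = ∫_{(−2,−1)} P_τ(z) dτ` of the slice pressures of a classical power clock is
the slice pressure `P_{−1}` plus a constant. [folklore] -/
theorem exists_avgPressure_eq_add_const (hcl : IsClassicalEulerSolutionOn (Iio 0) 0 u p) (hT₀ : 0 ≤ T₀)
    (hW : ∀ τ : ℝ, τ < 0 → ∀ y, u τ y = (T₀ - τ) ^ (g - 1) • W ((T₀ - τ) ^ (-g) • y)) :
    ∃ k : ℝ, ∀ z : EuclideanSpace ℝ (Fin 3),
      (∫ τ in Ioo (-2 : ℝ) (-1), (((T₀ - τ) ^ (g - 1)) ^ 2)⁻¹ * p τ ((T₀ - τ) ^ g • z)) =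
        (((T₀ - (-1)) ^ (g - 1)) ^ 2)⁻¹ * p (-1) ((T₀ - (-1)) ^ g • z) + k := by
  -- adapted from `BreatherRigidity.exists_avgPressure_eq_add_const`
  set kf : ℝ → ℝ := fun τ => (((T₀ - τ) ^ (g - 1)) ^ 2)⁻¹ * p τ ((T₀ - τ) ^ g • 0) -
    (((T₀ - (-1)) ^ (g - 1)) ^ 2)⁻¹ * p (-1) ((T₀ - (-1)) ^ g • 0) with hkf
  have hkc : ContinuousOn kf (Icc (-2 : ℝ) (-1)) :=
    ((continuousOn_slicePressure_time (g := g) hcl hT₀ 0).mono (fun τ hτ => by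
      have := hτ.2; rw [mem_Iio]; linarith)).sub continuousOn_const
  have hki : IntegrableOn kf (Ioo (-2 : ℝ) (-1)) volume :=
    (hkc.integrableOn_Icc).mono_set Ioo_subset_Icc_self
  refine ⟨∫ τ in Ioo (-2 : ℝ) (-1), kf τ, fun z => ?_⟩
  have hpt : ∀ τ ∈ Ioo (-2 : ℝ) (-1), (((T₀ - τ) ^ (g - 1)) ^ 2)⁻¹ * p τ ((T₀ - τ) ^ g • z) =
      (((T₀ - (-1)) ^ (g - 1)) ^ 2)⁻¹ * p (-1) ((T₀ - (-1)) ^ g • z) + kf τ := by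
    intro τ hτ
    have hτ0 : τ < 0 := by have := hτ.2; linarith
    have h := slicePressure_sub_eq hcl hT₀ hW hτ0 (by norm_num : (-1 : ℝ) < 0) z
    simp only [hkf]
    linarith
  rw [setIntegral_congr_fun measurableSet_Ioo hpt, integral_add _ hki, setIntegral_const, measureReal_def, Real.volume_Ioo,
    show (-1 : ℝ) - -2 = 1 by ring, ENNReal.toReal_ofReal zero_le_one, one_smul]
  exact (integrableOn_const_iff).2 (Or.inr (by rw [Real.volume_Ioo]; exact ENNReal.ofReal_lt_top))

/-- The averaged slice pressure is smooth and solves **the power-clock profile equation**: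
`(1−γ) W + γ (z·∇)W + (W·∇)W + ∇P̄ = 0`. [folklore] -/
theorem profile_equation_avg (hcl : IsClassicalEulerSolutionOn (Iio 0) 0 u p) (hT₀ : 0 ≤ T₀)
    (hW : ∀ τ : ℝ, τ < 0 → ∀ y, u τ y = (T₀ - τ) ^ (g - 1) • W ((T₀ - τ) ^ (-g) • y)) :
    ContDiff ℝ ∞ (fun z : EuclideanSpace ℝ (Fin 3) =>
        ∫ τ in Ioo (-2 : ℝ) (-1), (((T₀ - τ) ^ (g - 1)) ^ 2)⁻¹ * p τ ((T₀ - τ) ^ g • z)) ∧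
      ∀ z : EuclideanSpace ℝ (Fin 3), (1 - g) • W z + g • fderiv ℝ W z z + fderiv ℝ W z (W z) +
        gradient (fun z : EuclideanSpace ℝ (Fin 3) =>
          ∫ τ in Ioo (-2 : ℝ) (-1), (((T₀ - τ) ^ (g - 1)) ^ 2)⁻¹ * p τ ((T₀ - τ) ^ g • z)) z = 0 := by
  obtain ⟨k, hk⟩ := exists_avgPressure_eq_add_const hcl hT₀ hW
  have hfun : (fun z : EuclideanSpace ℝ (Fin 3) =>
      ∫ τ in Ioo (-2 : ℝ) (-1), (((T₀ - τ) ^ (g - 1)) ^ 2)⁻¹ * p τ ((T₀ - τ) ^ g • z)) =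
      fun z => (((T₀ - (-1)) ^ (g - 1)) ^ 2)⁻¹ * p (-1) ((T₀ - (-1)) ^ g • z) + k := funext hk
  have h1 : (-1 : ℝ) < 0 := by norm_num
  have hP1 := contDiff_slicePressure (T₀ := T₀) (g := g) hcl h1
  rw [hfun]
  refine ⟨hP1.add contDiff_const, fun z => ?_⟩
  have hgrad : gradient (fun z => (((T₀ - (-1)) ^ (g - 1)) ^ 2)⁻¹ * p (-1) ((T₀ - (-1)) ^ g • z) + k) z =
      gradient (fun z => (((T₀ - (-1)) ^ (g - 1)) ^ 2)⁻¹ * p (-1) ((T₀ - (-1)) ^ g • z)) z := by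
    unfold gradient
    rw [fderiv_add_const]
  rw [hgrad]
  exact profile_equation hcl hT₀ hW h1 z

/-! ### `D`-growth of the averaged slice pressure -/

/-- **THE `D`-GAUGE CONTROLS THE AVERAGED SLICE PRESSURE (large scales, no loss).**  If `(u, p)` is classical on `(−∞,0)`,
`T₀ ≥ 0`, `0 ≤ γ ≤ 1`, and `a^{2ρ} D(a; 0; p) ≤ c₀` for all `a > 0`, then with `S = T₀ + 2`, for every `L ≥ 2`,
`∫_{B_L} |P̄(z)|^{3/2} dz ≤ (S^{2−2γ})^{3/2} (S^{γ})^{2−2ρ} c₀ · L^{2−2ρ}`, `P̄(z) = ∫_{(−2,−1)} ((T₀−τ)^{γ−1})^{−2} p(τ, (T₀−τ)^{γ} z) dτ`. [folklore] -/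
theorem lintegral_ball_avgPressure_le {ρ : ℝ} {c₀ : ℝ≥0} (hcl : IsClassicalEulerSolutionOn (Iio 0) 0 u p) (hT₀ : 0 ≤ T₀)
    (hg0 : 0 ≤ g) (hg1 : g ≤ 1)
    (hD : ∀ a : ℝ, 0 < a →
      ENNReal.ofReal (a ^ (2 * ρ)) * cknD a (0 : ℝ × EuclideanSpace ℝ (Fin 3)) p ≤ (c₀ : ℝ≥0∞))
    {L : ℝ} (hL : 2 ≤ L) :
    ∫⁻ z in ball (0 : EuclideanSpace ℝ (Fin 3)) L,
        ‖∫ τ in Ioo (-2 : ℝ) (-1), (((T₀ - τ) ^ (g - 1)) ^ 2)⁻¹ * p τ ((T₀ - τ) ^ g • z)‖ₑ ^ (3 / 2 : ℝ) ≤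
      ENNReal.ofReal (((T₀ + 2) ^ (2 - 2 * g)) ^ (3 / 2 : ℝ) * ((T₀ + 2) ^ g) ^ (2 - 2 * ρ)) * (c₀ : ℝ≥0∞) *
        ENNReal.ofReal (L ^ (2 - 2 * ρ)) := by
  -- adapted from `BreatherRigidity.lintegral_ball_avgPressure_le`
  have hL0 : 0 < L := by linarith
  set S : ℝ := T₀ + 2 with hS
  have hS0 : 0 < S := by rw [hS]; linarith
  have hS1 : 1 ≤ S := by rw [hS]; linarith
  set σ : ℝ := S ^ g with hσ
  have hσ1 : 1 ≤ σ := Real.one_le_rpow hS1 hg0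
  have hσ0 : 0 < σ := by linarith
  set a : ℝ := σ * L with ha
  have haL : L ≤ a := by rw [ha]; nlinarith
  have ha0 : 0 < a := by linarith
  have hcont := continuousOn_slicePressure_uncurry (g := g) hcl hT₀
  set Ps : ℝ → EuclideanSpace ℝ (Fin 3) → ℝ := fun τ z => (((T₀ - τ) ^ (g - 1)) ^ 2)⁻¹ * p τ ((T₀ - τ) ^ g • z) with hPs
  set KA : ℝ := (S ^ (2 - 2 * g)) ^ (3 / 2 : ℝ) with hKA
  have hKA0 : 0 ≤ KA := Real.rpow_nonneg (Real.rpow_nonneg hS0.le _) _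
  -- ### (1) the gauge: `X = ∫∫_{Q_a} |p|^{3/2} ≤ a^{2−2ρ} c₀`
  set X : ℝ≥0∞ := ∫⁻ q in parabolicCylinder a (0 : ℝ × EuclideanSpace ℝ (Fin 3)),
    ‖p q.1 q.2‖ₑ ^ (3 / 2 : ℝ) with hX
  have hXle : X ≤ ENNReal.ofReal (a ^ (2 - 2 * ρ)) * (c₀ : ℝ≥0∞) := by
    have h1 := hD a ha0
    unfold cknD at h1
    have hB0 : ENNReal.ofReal (a ^ (2 * ρ)) ≠ 0 := by
      rw [ENNReal.ofReal_ne_zero_iff]; exact Real.rpow_pos_of_pos ha0 _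
    have hA0 : ENNReal.ofReal a ^ 2 ≠ 0 := pow_ne_zero _ (by rw [ENNReal.ofReal_ne_zero_iff]; exact ha0)
    have hAt : ENNReal.ofReal a ^ 2 ≠ ⊤ := ENNReal.pow_ne_top ENNReal.ofReal_ne_top
    have key : X = ENNReal.ofReal a ^ 2 * (ENNReal.ofReal (a ^ (2 * ρ)))⁻¹ *
        (ENNReal.ofReal (a ^ (2 * ρ)) * ((ENNReal.ofReal a ^ 2)⁻¹ * X)) := by
      rw [← mul_assoc, mul_assoc (ENNReal.ofReal a ^ 2), ENNReal.inv_mul_cancel hB0 ENNReal.ofReal_ne_top,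
        mul_one, ← mul_assoc, ENNReal.mul_inv_cancel hA0 hAt, one_mul]
    calc X = _ := key
      _ ≤ ENNReal.ofReal a ^ 2 * (ENNReal.ofReal (a ^ (2 * ρ)))⁻¹ * (c₀ : ℝ≥0∞) := by gcongr
      _ = ENNReal.ofReal (a ^ (2 - 2 * ρ)) * (c₀ : ℝ≥0∞) := by
          rw [← ENNReal.ofReal_inv_of_pos (Real.rpow_pos_of_pos ha0 _), ← ENNReal.ofReal_pow ha0.le,
            ← ENNReal.ofReal_mul (by positivity)]
          congr 2
          rw [Real.rpow_sub ha0, show a ^ (2 : ℝ) = a ^ (2 : ℕ) by exact_mod_cast Real.rpow_natCast a 2,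
            div_eq_mul_inv]
  -- ### (2) the window `(−2,−1) × B_a ⊆ Q_a(0,0)` and Tonelli for `p`
  have hWsub : Ioo (-2 : ℝ) (-1) ×ˢ ball (0 : EuclideanSpace ℝ (Fin 3)) a ⊆
      parabolicCylinder a (0 : ℝ × EuclideanSpace ℝ (Fin 3)) := by
    intro q hq
    rw [mem_prod, mem_Ioo, mem_ball] at hq
    rw [mem_parabolicCylinder, Prod.fst_zero, Prod.snd_zero, zero_sub]
    have ha2 : (2 : ℝ) ≤ a ^ 2 := by nlinarith
    exact ⟨⟨by linarith [hq.1.1], by linarith [hq.1.2]⟩, hq.2⟩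
  have hsubW : Ioo (-2 : ℝ) (-1) ×ˢ ball (0 : EuclideanSpace ℝ (Fin 3)) a ⊆ Iio (0 : ℝ) ×ˢ univ :=
    prod_mono (fun t ht => by have := ht.2; rw [mem_Iio]; linarith) (subset_univ _)
  have hpmW : AEMeasurable (fun q : ℝ × EuclideanSpace ℝ (Fin 3) => ‖p q.1 q.2‖ₑ ^ (3 / 2 : ℝ))
      (((volume : Measure ℝ).restrict (Ioo (-2 : ℝ) (-1))).prod
        ((volume : Measure (EuclideanSpace ℝ (Fin 3))).restrict (ball 0 a))) := by
    have hpc : ContinuousOn (uncurry p) (Ioo (-2 : ℝ) (-1) ×ˢ ball (0 : EuclideanSpace ℝ (Fin 3)) a) :=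
      hcl.smooth_pressure.continuousOn.mono hsubW
    have h : AEMeasurable (fun q : ℝ × EuclideanSpace ℝ (Fin 3) => ‖uncurry p q‖ₑ ^ (3 / 2 : ℝ))
        (volume.restrict (Ioo (-2 : ℝ) (-1) ×ˢ ball (0 : EuclideanSpace ℝ (Fin 3)) a)) :=
      (hpc.aestronglyMeasurable (measurableSet_Ioo.prod measurableSet_ball)).enorm.pow_const (3 / 2 : ℝ)
    rw [Measure.volume_eq_prod, ← Measure.prod_restrict] at h
    exact h
  have hYeq : ∫⁻ q in Ioo (-2 : ℝ) (-1) ×ˢ ball (0 : EuclideanSpace ℝ (Fin 3)) a, ‖p q.1 q.2‖ₑ ^ (3 / 2 : ℝ) =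
      ∫⁻ τ in Ioo (-2 : ℝ) (-1), ∫⁻ x in ball (0 : EuclideanSpace ℝ (Fin 3)) a, ‖p τ x‖ₑ ^ (3 / 2 : ℝ) := by
    rw [Measure.volume_eq_prod, ← Measure.prod_restrict, lintegral_prod _ hpmW]
  have hY : ∫⁻ τ in Ioo (-2 : ℝ) (-1), ∫⁻ x in ball (0 : EuclideanSpace ℝ (Fin 3)) a, ‖p τ x‖ₑ ^ (3 / 2 : ℝ) ≤ X := by
    rw [← hYeq]; exact lintegral_mono_set hWsub
  -- ### (3) pointwise power mean and Tonelli for the slice-pressure family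
  have hvolI : volume (Ioo (-2 : ℝ) (-1)) = 1 := by
    rw [Real.volume_Ioo, show (-1 : ℝ) - -2 = 1 by ring, ENNReal.ofReal_one]
  have hJ : ∀ z : EuclideanSpace ℝ (Fin 3), ‖∫ τ in Ioo (-2 : ℝ) (-1), Ps τ z‖ₑ ^ (3 / 2 : ℝ) ≤
      ∫⁻ τ in Ioo (-2 : ℝ) (-1), ‖Ps τ z‖ₑ ^ (3 / 2 : ℝ) := by
    intro z
    refine BreatherRigidity.enorm_setIntegral_rpow_le hvolI ?_
    exact ((continuousOn_slicePressure_time (g := g) hcl hT₀ z).mono (fun t ht => by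
      have := ht.2; rw [mem_Iio]; linarith)).aestronglyMeasurable measurableSet_Ioo
  have hPsm : AEMeasurable (uncurry fun (z : EuclideanSpace ℝ (Fin 3)) (τ : ℝ) => ‖Ps τ z‖ₑ ^ (3 / 2 : ℝ))
      (((volume : Measure (EuclideanSpace ℝ (Fin 3))).restrict (ball 0 L)).prod
        ((volume : Measure ℝ).restrict (Ioo (-2 : ℝ) (-1)))) := by
    have hsw : Continuous fun w : EuclideanSpace ℝ (Fin 3) × ℝ => ((w.2, w.1) : ℝ × EuclideanSpace ℝ (Fin 3)) := by fun_prop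
    have hF0 := hcont.comp (hsw.continuousOn (s := ball (0 : EuclideanSpace ℝ (Fin 3)) L ×ˢ Ioo (-2 : ℝ) (-1)))
      (fun w hw => ⟨by have := hw.2.2; rw [mem_Iio]; linarith, mem_univ _⟩)
    have hF : ContinuousOn (fun w : EuclideanSpace ℝ (Fin 3) × ℝ => Ps w.2 w.1)
        (ball (0 : EuclideanSpace ℝ (Fin 3)) L ×ˢ Ioo (-2 : ℝ) (-1)) := by
      refine hF0.congr fun w _ => ?_
      simp only [Function.comp_apply, hPs]
    have h : AEMeasurable (fun w : EuclideanSpace ℝ (Fin 3) × ℝ => ‖Ps w.2 w.1‖ₑ ^ (3 / 2 : ℝ))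
        (volume.restrict (ball (0 : EuclideanSpace ℝ (Fin 3)) L ×ˢ Ioo (-2 : ℝ) (-1))) :=
      (hF.aestronglyMeasurable (measurableSet_ball.prod measurableSet_Ioo)).enorm.pow_const (3 / 2 : ℝ)
    rw [Measure.volume_eq_prod, ← Measure.prod_restrict] at h
    exact h
  have hswap : ∫⁻ z in ball (0 : EuclideanSpace ℝ (Fin 3)) L, ∫⁻ τ in Ioo (-2 : ℝ) (-1), ‖Ps τ z‖ₑ ^ (3 / 2 : ℝ) =
      ∫⁻ τ in Ioo (-2 : ℝ) (-1), ∫⁻ z in ball (0 : EuclideanSpace ℝ (Fin 3)) L, ‖Ps τ z‖ₑ ^ (3 / 2 : ℝ) :=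
    lintegral_lintegral_swap hPsm
  -- ### (4) the slices: `∫_{B_L}|P_τ|^{3/2} ≤ KA ∫_{B_a}|p(τ)|^{3/2}` for `τ ∈ (−2,−1)`
  have hslice : ∀ τ ∈ Ioo (-2 : ℝ) (-1), ∫⁻ z in ball (0 : EuclideanSpace ℝ (Fin 3)) L, ‖Ps τ z‖ₑ ^ (3 / 2 : ℝ) ≤
      ENNReal.ofReal KA * ∫⁻ x in ball (0 : EuclideanSpace ℝ (Fin 3)) a, ‖p τ x‖ₑ ^ (3 / 2 : ℝ) := by
    intro τ hτ
    have hs : 0 < T₀ - τ := by have := hτ.2; linarith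
    have hs1 : 1 ≤ T₀ - τ := by have := hτ.2; linarith
    have hsS : T₀ - τ ≤ S := by have := hτ.1; rw [hS]; linarith
    set ℓ : ℝ := (T₀ - τ) ^ g with hℓ
    have hℓ0 : 0 < ℓ := Real.rpow_pos_of_pos hs _
    have hℓ1 : 1 ≤ ℓ := Real.one_le_rpow hs1 hg0
    -- the amplitude factor `((s^{γ−1})²)⁻¹ = s^{2−2γ} ≤ S^{2−2γ}`
    have hampR : (((T₀ - τ) ^ (g - 1)) ^ 2)⁻¹ ≤ S ^ (2 - 2 * g) := by
      have e1 : (((T₀ - τ) ^ (g - 1)) ^ 2)⁻¹ = (T₀ - τ) ^ (2 - 2 * g) := by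
        rw [← Real.rpow_natCast, ← Real.rpow_mul hs.le, ← Real.rpow_neg hs.le]
        congr 1; push_cast; ring
      rw [e1]
      exact Real.rpow_le_rpow hs.le hsS (by linarith)
    have hamp0 : 0 ≤ (((T₀ - τ) ^ (g - 1)) ^ 2)⁻¹ := by positivity
    have hamp : ‖(((T₀ - τ) ^ (g - 1)) ^ 2)⁻¹‖ₑ ^ (3 / 2 : ℝ) ≤ ENNReal.ofReal KA := by
      have h2 : ‖(((T₀ - τ) ^ (g - 1)) ^ 2)⁻¹‖ₑ ≤ ENNReal.ofReal (S ^ (2 - 2 * g)) := by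
        rw [Real.enorm_eq_ofReal hamp0]
        exact ENNReal.ofReal_le_ofReal hampR
      calc ‖(((T₀ - τ) ^ (g - 1)) ^ 2)⁻¹‖ₑ ^ (3 / 2 : ℝ) ≤ ENNReal.ofReal (S ^ (2 - 2 * g)) ^ (3 / 2 : ℝ) :=
            ENNReal.rpow_le_rpow h2 (by norm_num)
        _ = ENNReal.ofReal KA := by
            rw [hKA, ENNReal.ofReal_rpow_of_nonneg (Real.rpow_nonneg hS0.le _) (by norm_num)]
    -- pointwise
    have hpt : ∀ z, ‖Ps τ z‖ₑ ^ (3 / 2 : ℝ) ≤ ENNReal.ofReal KA * ‖p τ (ℓ • z)‖ₑ ^ (3 / 2 : ℝ) := by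
      intro z
      simp only [hPs, hℓ]
      rw [enorm_mul, ENNReal.mul_rpow_of_nonneg _ _ (by norm_num : (0 : ℝ) ≤ 3 / 2)]
      exact mul_le_mul' hamp le_rfl
    -- the dilation `z ↦ ℓ z`
    have hdil : ∫⁻ z in ball (0 : EuclideanSpace ℝ (Fin 3)) L, ‖p τ (ℓ • z)‖ₑ ^ (3 / 2 : ℝ) ≤
        ∫⁻ x in ball (0 : EuclideanSpace ℝ (Fin 3)) a, ‖p τ x‖ₑ ^ (3 / 2 : ℝ) := by
      rw [lintegral_ball_comp_smul (fun x => ‖p τ x‖ₑ ^ (3 / 2 : ℝ)) hℓ0 L]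
      have h1 : (ℓ ^ 3)⁻¹ ≤ 1 := inv_le_one_of_one_le₀ (one_le_pow₀ hℓ1)
      have h2 : ℓ * L ≤ a := by
        have : ℓ ≤ σ := by rw [hℓ, hσ]; exact Real.rpow_le_rpow hs.le hsS hg0
        rw [ha]; nlinarith
      calc ENNReal.ofReal ((ℓ ^ 3)⁻¹) * ∫⁻ x in ball (0 : EuclideanSpace ℝ (Fin 3)) (ℓ * L), ‖p τ x‖ₑ ^ (3 / 2 : ℝ)
          ≤ 1 * ∫⁻ x in ball (0 : EuclideanSpace ℝ (Fin 3)) a, ‖p τ x‖ₑ ^ (3 / 2 : ℝ) :=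
            mul_le_mul' (by rw [← ENNReal.ofReal_one]; exact ENNReal.ofReal_le_ofReal h1)
              (lintegral_mono_set (ball_subset_ball h2))
        _ = _ := one_mul _
    calc ∫⁻ z in ball (0 : EuclideanSpace ℝ (Fin 3)) L, ‖Ps τ z‖ₑ ^ (3 / 2 : ℝ)
        ≤ ∫⁻ z in ball (0 : EuclideanSpace ℝ (Fin 3)) L, ENNReal.ofReal KA * ‖p τ (ℓ • z)‖ₑ ^ (3 / 2 : ℝ) :=
          lintegral_mono fun z => hpt z
      _ = ENNReal.ofReal KA * ∫⁻ z in ball (0 : EuclideanSpace ℝ (Fin 3)) L, ‖p τ (ℓ • z)‖ₑ ^ (3 / 2 : ℝ) :=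
          lintegral_const_mul' _ _ ENNReal.ofReal_ne_top
      _ ≤ ENNReal.ofReal KA * ∫⁻ x in ball (0 : EuclideanSpace ℝ (Fin 3)) a, ‖p τ x‖ₑ ^ (3 / 2 : ℝ) :=
          mul_le_mul' le_rfl hdil
  -- ### (5) assemble
  have haρ : a ^ (2 - 2 * ρ) = σ ^ (2 - 2 * ρ) * L ^ (2 - 2 * ρ) := by
    rw [ha, Real.mul_rpow hσ0.le hL0.le]
  calc ∫⁻ z in ball (0 : EuclideanSpace ℝ (Fin 3)) L, ‖∫ τ in Ioo (-2 : ℝ) (-1), Ps τ z‖ₑ ^ (3 / 2 : ℝ)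
      ≤ ∫⁻ z in ball (0 : EuclideanSpace ℝ (Fin 3)) L, ∫⁻ τ in Ioo (-2 : ℝ) (-1), ‖Ps τ z‖ₑ ^ (3 / 2 : ℝ) :=
        lintegral_mono fun z => hJ z
    _ = ∫⁻ τ in Ioo (-2 : ℝ) (-1), ∫⁻ z in ball (0 : EuclideanSpace ℝ (Fin 3)) L, ‖Ps τ z‖ₑ ^ (3 / 2 : ℝ) := hswap
    _ ≤ ∫⁻ τ in Ioo (-2 : ℝ) (-1), ENNReal.ofReal KA *
          ∫⁻ x in ball (0 : EuclideanSpace ℝ (Fin 3)) a, ‖p τ x‖ₑ ^ (3 / 2 : ℝ) :=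
        setLIntegral_mono_ae' measurableSet_Ioo (Eventually.of_forall fun τ hτ => hslice τ hτ)
    _ = ENNReal.ofReal KA *
          ∫⁻ τ in Ioo (-2 : ℝ) (-1), ∫⁻ x in ball (0 : EuclideanSpace ℝ (Fin 3)) a, ‖p τ x‖ₑ ^ (3 / 2 : ℝ) :=
        lintegral_const_mul' _ _ ENNReal.ofReal_ne_top
    _ ≤ ENNReal.ofReal KA * X := mul_le_mul' le_rfl hY
    _ ≤ ENNReal.ofReal KA * (ENNReal.ofReal (a ^ (2 - 2 * ρ)) * (c₀ : ℝ≥0∞)) := mul_le_mul' le_rfl hXle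
    _ = ENNReal.ofReal (KA * σ ^ (2 - 2 * ρ)) * (c₀ : ℝ≥0∞) * ENNReal.ofReal (L ^ (2 - 2 * ρ)) := by
        rw [haρ, ENNReal.ofReal_mul (by positivity), ENNReal.ofReal_mul hKA0]
        ring

end PowerClockRigidity

end Summit.NavierStokesRegularity.NavierStokesRegularity.Theorems.PowerGaugeEulerLiouville

end
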